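import Literature.AlgebraicGeometry.Resolution.AbhyankarEtaleAscentProofs
import Literature.AlgebraicGeometry.Resolution.FiniteExtensionUniformizationProofs
import Literature.AlgebraicGeometry.Resolution.RegularLocalRingsNormal
import Literature.AlgebraicGeometry.Resolution.SmoothUniformizationProofs
import Literature.AlgebraicGeometry.Resolution.ValuedFunctionFieldsLemmas
import Literature.AlgebraicGeometry.Resolution.NormalizationFractions
import HarnessLib

/-!
# Relative local uniformization is free at Abhyankar places

Topic: `Literature/AlgebraicGeometry/Resolution`. Load-bearing analysis recorded by the standing
disprover of crux `PatchingRel` (stmt-ResolutionOfSingularities-0642, `LUrel_p → ResolutionInChar p`;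
`Cruxes/PatchingRel/Disproof.lean` §2 (H8c)): the antecedent `LUrel_p` — RELATIVE local
uniformization in the affine-model form "every finitely generated `R ⊆ O` is dominated by a
finitely generated `A`, `R ≤ A ⊆ O`, `Frac A = K`, `A` regular at the centre of `O`" — HOLDS at
every ABHYANKAR place of a function field `K/k` (equality in Abhyankar's inequality,
`IsAbhyankarPlace`, `ValuedFunctionFields.lean`) whose residue field extension is separably
generated, in particular at every Abhyankar place when `k` is perfect. This is Knaf–Kuhlmann
2005, Thm. 1.1 ("every Abhyankar place admits local uniformization", PROVED in the tree:
`KnafKuhlmann2005_Thm11_holds`) in the crux's vocabulary: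

* `relLU_at_abhyankarPlace` — separably generated residue extension;
* `relLU_at_abhyankarPlace_of_perfectField` — `k` perfect (the residue field extension of an
  Abhyankar place is finitely generated, Knaf–Kuhlmann 2005 Cor. 2.2 =
  `KnafKuhlmann2005_Cor22_holds`, hence separably generated over the perfect `KP`,
  `separablyGeneratedOver_of_perfectField`).

Glue: the prescribed generators of `R` are the finite set `Z` of Thm. 1.1; the smooth model with
`Z ⊆ A_q` is improved to an everywhere smooth model CONTAINING `Z` (`exists_normal_smooth_model`,
inverting denominators of value `1`), which is regular at every prime (EGA IV 17.5.8,
`Grothendieck1967_17_5_8_holds`), and re-read as a `k`-subalgebra with the same underlying ring.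

Consequence for the crux (Disproof.lean (H7), (H8), (H8c)): over a perfect ground field the
antecedent `LUrel_p` has content only at NON-Abhyankar valuations (positive transcendence or
rank defect in Abhyankar's inequality — Kuhlmann's defect world), and by (H8) only at the
zero-dimensional ones among them.

## Sources

* H. Knaf, F.-V. Kuhlmann, *Abhyankar places admit local uniformization in any
  characteristic*, Ann. Sci. ÉNS 38 (2005) 833–846: Thm. 1.1, Cor. 2.2. [KnafKuhlmann2005]
-/

open IsLocalRing

namespace Literature.AlgebraicGeometry.Resolution

universe u

/-- **Relative local uniformization at an Abhyankar place with separably generated residue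
field extension** (Knaf–Kuhlmann 2005, Thm. 1.1, in affine-model form): for a function field
`K/k`, a valuation ring `O ⊇ k` of `K` which is an Abhyankar place of `K | k` with `κ(O) | k`
separably generated, and a finitely generated `k`-subalgebra `R ⊆ O`, there is a finitely
generated `A` with `R ≤ A ⊆ O`, `Frac A = K` and `A` regular at the centre `𝔪_O ∩ A`.
[cite: KnafKuhlmann2005, Thm. 1.1] -/
theorem relLU_at_abhyankarPlace {k K : Type u} [Field k] [Field K] [Algebra k K]
    (hKfg : (⊤ : IntermediateField k K).FG) (O : ValuationSubring K)
    (hO : ∀ c : k, algebraMap k K c ∈ O)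
    (hAbh : IsAbhyankarPlace O (algebraMap k K).fieldRange ⊤)
    (hsep : SeparablyGeneratedOver (resField O (algebraMap k K).fieldRange) (resField O ⊤))
    (R : Subalgebra k K) (hRfg : R.FG) (hRO : R.toSubring ≤ O.toSubring) :
    ∃ (A : Subalgebra k K) (h : A.toSubring ≤ O.toSubring), R ≤ A ∧ A.FG ∧ IsFractionRing A K ∧
      IsRegularLocalRing (Localization.AtPrime
        (Ideal.comap (Subring.inclusion h) (IsLocalRing.maximalIdeal O))) := by
  classical
  set K₀ : Subfield K := (algebraMap k K).fieldRange with hK₀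
  have hK₀O : (K₀ : Set K) ⊆ O := by
    rintro x ⟨c, rfl⟩
    exact hO c
  -- `K = K₀(s)` is finitely generated over `K₀`
  have hfg : FGOver K₀ (⊤ : Subfield K) := by
    obtain ⟨s, hs⟩ := hKfg
    refine ⟨s, ?_⟩
    have h1 : (IntermediateField.adjoin k (s : Set K)).toSubfield =
        Subfield.closure (Set.range (algebraMap k K) ∪ (s : Set K)) := rfl
    rw [RingHom.coe_fieldRange, ← h1, hs]
    rfl
  -- generators of `R`: the finite set `Z` of Thm. 1.1
  obtain ⟨t, ht⟩ := hRfg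
  have htR : (t : Set K) ⊆ R := ht ▸ Algebra.subset_adjoin
  have hZ : ∀ z ∈ t, z ∈ O ∧ z ∈ (⊤ : Subfield K) := fun z hz => ⟨hRO (htR hz), trivial⟩
  -- Knaf–Kuhlmann 2005, Thm 1.1
  have hSU : IsSmoothlyUniformizableIn K₀ O (⊤ : Subfield K) (t : Set K) :=
    KnafKuhlmann2005_Thm11_holds K O K₀ ⊤ le_top hfg hK₀O hAbh hsep t hZ
  -- an everywhere smooth model containing `t`
  obtain ⟨B, hBO, -, hBfg, hBsm, -, htB, hfrac⟩ :=
    exists_normal_smooth_model Grothendieck1967_17_5_8_holds Matsumura1987_19_4_holds hSU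
  haveI := hBsm
  haveI : Algebra.FiniteType K₀ B := (Subalgebra.fg_iff_finiteType B).mp hBfg
  -- the same subring as a `k`-subalgebra
  let A : Subalgebra k K :=
    { B.toSubring.toSubsemiring with
      algebraMap_mem' := fun c => B.algebraMap_mem (⟨algebraMap k K c, c, rfl⟩ : K₀) }
  refine ⟨A, hBO, ?_, ?_, ?_, ?_⟩
  · -- `R ≤ A`
    rw [← ht]
    exact Algebra.adjoin_le fun z hz => htB hz
  · -- `A` is finitely generated over `k` (by the `K₀`-generators of `B`)
    obtain ⟨t₂, ht₂⟩ := hBfg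
    refine ⟨t₂, le_antisymm (Algebra.adjoin_le fun x hx => ?_) fun x hx => ?_⟩
    · change x ∈ B
      rw [← ht₂]
      exact Algebra.subset_adjoin hx
    · let T : Subalgebra K₀ K :=
        { (Algebra.adjoin k (t₂ : Set K)).toSubring.toSubsemiring with
          algebraMap_mem' := fun c => by
            obtain ⟨c', hc'⟩ := c.2
            change (c : K) ∈ Algebra.adjoin k (t₂ : Set K)
            rw [← hc']
            exact (Algebra.adjoin k (t₂ : Set K)).algebraMap_mem c' }
      have hBT : B ≤ T := by
        rw [← ht₂]
        exact Algebra.adjoin_le fun y hy => (Algebra.subset_adjoin hy : y ∈ Algebra.adjoin k _)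
      exact hBT hx
  · -- `Frac A = K`
    exact isFractionRing_of_forall_exists_div A.toSubring fun z => hfrac z trivial
  · -- regular at the centre: smooth over the field `K₀` (EGA IV 17.5.8)
    exact Grothendieck1967_17_5_8.of_field Grothendieck1967_17_5_8_holds K₀ B
      (centre B O hBO) (isSmoothAt_of_formallySmooth _)

/-- **Relative local uniformization at every Abhyankar place over a perfect ground field**
(Knaf–Kuhlmann 2005, Thm. 1.1 with Cor. 2.2: the residue field extension of an Abhyankar place
of a function field is finitely generated, hence separably generated over the perfect residue
field of `k`). [cite: KnafKuhlmann2005, Thm. 1.1 and Cor. 2.2] -/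
theorem relLU_at_abhyankarPlace_of_perfectField {k K : Type u} [Field k] [PerfectField k]
    [Field K] [Algebra k K]
    (hKfg : (⊤ : IntermediateField k K).FG) (O : ValuationSubring K)
    (hO : ∀ c : k, algebraMap k K c ∈ O)
    (hAbh : IsAbhyankarPlace O (algebraMap k K).fieldRange ⊤)
    (R : Subalgebra k K) (hRfg : R.FG) (hRO : R.toSubring ≤ O.toSubring) :
    ∃ (A : Subalgebra k K) (h : A.toSubring ≤ O.toSubring), R ≤ A ∧ A.FG ∧ IsFractionRing A K ∧
      IsRegularLocalRing (Localization.AtPrime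
        (Ideal.comap (Subring.inclusion h) (IsLocalRing.maximalIdeal O))) := by
  set K₀ : Subfield K := (algebraMap k K).fieldRange with hK₀
  haveI : PerfectField K₀ := PerfectField.of_ringEquiv (algebraMap k K).rangeRestrictFieldEquiv
  have hK₀O : (K₀ : Set K) ⊆ O := by
    rintro x ⟨c, rfl⟩
    exact hO c
  have hfg : FGOver K₀ (⊤ : Subfield K) := by
    obtain ⟨s, hs⟩ := hKfg
    refine ⟨s, ?_⟩
    have h1 : (IntermediateField.adjoin k (s : Set K)).toSubfield =
        Subfield.closure (Set.range (algebraMap k K) ∪ (s : Set K)) := rfl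
    rw [RingHom.coe_fieldRange, ← h1, hs]
    rfl
  obtain ⟨-, hresfg⟩ := KnafKuhlmann2005_Cor22_holds K O K₀ ⊤ le_top hfg hAbh
  haveI : PerfectField (resField O K₀) := perfectField_resField hK₀O
  exact relLU_at_abhyankarPlace hKfg O hO hAbh (separablyGeneratedOver_of_perfectField hresfg)
    R hRfg hRO

end Literature.AlgebraicGeometry.Resolution

/-! ## Abhyankar places over an arbitrary ground field: Cutkosky 2022 (named fact) -/

namespace Literature.AlgebraicGeometry.Resolution

universe u

/-- NAMED FACT — **Cutkosky 2022, Thm. 1.3** (local uniformization of Abhyankar valuations over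
an ARBITRARY ground field; relative affine-model form): "Suppose that `K` is an algebraic
function field over a field `k` and `ν` is an Abhyankar valuation of `K`. Suppose that `S` is an
algebraic local ring of `K` which is dominated by `ν`. Then there exists a birational extension
`S → R` such that `R` is a regular algebraic local ring of `K` which is dominated by `ν` and
satisfies the conclusions 1) and 2) of Theorem 1.1 [very good regular parameters]." This removes
the separability hypothesis of Knaf–Kuhlmann 2005, Thm. 1.1 (`relLU_at_abhyankarPlace` above);
the model is then regular, in general NOT smooth over `k` (p. 2 of the paper). Vendored WITHOUT
the clauses on very good parameters and in the affine-model vocabulary of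
`relLU_at_abhyankarPlace`: for a finitely generated field extension `K/k`, a valuation ring
`O ⊇ k` of `K` which is an Abhyankar place of `K | k` (`IsAbhyankarPlace`: equality in
Abhyankar's inequality) and a finitely generated `k`-subalgebra `S ⊆ O`, there is a finitely
generated `A` with `S ≤ A ⊆ O`, `Frac A = K` and `A` regular at the centre `𝔪_O ∩ A` (apply
Thm. 1.3 to the local ring at the centre of `ν` on `S` enlarged by numerators and denominators of
generators of `K`; an affine model of `R` enlarged by the finitely many generators of `S ⊆ R`
has the same local ring at the centre). The proof in the paper (§§3–5) is a Zariski–Perron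
reduction algorithm in completions with pseudo-valuations and is not in the tree. Users take
`(h : Cutkosky2022_Thm13)`. [cite: Cutkosky2022, Thm. 1.3] -/
def Cutkosky2022_Thm13 : Prop :=
  ∀ (k K : Type u) [Field k] [Field K] [Algebra k K], (⊤ : IntermediateField k K).FG →
    ∀ (O : ValuationSubring K), (∀ c : k, algebraMap k K c ∈ O) →
      IsAbhyankarPlace O (algebraMap k K).fieldRange ⊤ →
      ∀ (S : Subalgebra k K), S.FG → S.toSubring ≤ O.toSubring →
        ∃ (A : Subalgebra k K) (h : A.toSubring ≤ O.toSubring), S ≤ A ∧ A.FG ∧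
          IsFractionRing A K ∧ IsRegularLocalRing (Localization.AtPrime
            (Ideal.comap (Subring.inclusion h) (IsLocalRing.maximalIdeal O)))

-- TODO(general form): Cutkosky 2022 Thms. 1.1/1.3 also give "very good" regular parameters
-- adapted to the composite structure of `ν` (conclusions 1), 2)), and Thm. 1.2 monomializes
-- any `f ∈ V_ν` (or any ideal of `R`) by primitive transforms along `ν`.

/-- The unconditional Knaf–Kuhlmann case is an instance of the named fact's conclusion: under a
separably generated residue field extension, `Cutkosky2022_Thm13`'s output exists by
`relLU_at_abhyankarPlace` (sanity link between the two renderings). [folklore] -/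
theorem Cutkosky2022_Thm13.conclusion_of_separablyGenerated {k K : Type u} [Field k] [Field K]
    [Algebra k K] (hKfg : (⊤ : IntermediateField k K).FG) (O : ValuationSubring K)
    (hO : ∀ c : k, algebraMap k K c ∈ O)
    (hAbh : IsAbhyankarPlace O (algebraMap k K).fieldRange ⊤)
    (hsep : SeparablyGeneratedOver (resField O (algebraMap k K).fieldRange) (resField O ⊤))
    (S : Subalgebra k K) (hSfg : S.FG) (hSO : S.toSubring ≤ O.toSubring) :
    ∃ (A : Subalgebra k K) (h : A.toSubring ≤ O.toSubring), S ≤ A ∧ A.FG ∧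
      IsFractionRing A K ∧ IsRegularLocalRing (Localization.AtPrime
        (Ideal.comap (Subring.inclusion h) (IsLocalRing.maximalIdeal O))) :=
  relLU_at_abhyankarPlace hKfg O hO hAbh hsep S hSfg hSO

end Literature.AlgebraicGeometry.Resolution
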